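/-
Copyright (c) 2026 the pub-hodgecm-mathlib formalisation cell (harness21).  Prover seat hodgecm-mathlib-LA5-p02 (g2), H1-DIM cut
(B-p04 (g42) deal 2026-09-02T03:52:21Z, FILE 5a «the stalk at a `K`-point of an affine test base as test algebra»).  KERNEL: theorems only.
-/
import Mathlib.AlgebraicGeometry.Stalk
import Mathlib.AlgebraicGeometry.AffineScheme
import Mathlib.AlgebraicGeometry.Morphisms.Separated
import Mathlib.AlgebraicGeometry.Morphisms.FiniteType
import Mathlib.AlgebraicGeometry.Noetherian
import Mathlib.RingTheory.LocalRing.ResidueField.Basic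
import Mathlib.RingTheory.Localization.AtPrime.Basic
import HarnessLib

/-!
# The stalk of an affine `K`-scheme at a `K`-rational point as a test algebra: closed point, `(ker t♯)·𝒪_x = 𝔪_x`, `κ(x) ≅ K`
# ([Hartshorne1977] II Ex. 2.7, II.2 (Prop. 2.2 (c)), II Ex. 3.14; [GortzWedhorn2020] §3.4 (Prop. 3.33), §4.4; [MumfordAV1970] §13)

Layer `Literature/AlgebraicGeometry/Morphisms`, namespace `Literature.AlgebraicGeometry.Morphisms`.  THEOREMS ONLY (no definition, no named
fact, no instance, no notation, no `sorry`), Mathlib only.  Cell `hodgecm-mathlib`, junction FILE 5a of the duality-free «H1-DIM any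
characteristic» cut (B-p04 memo v4 ∕ plan 2026-09-02T03:20:08Z, deal 03:52:21Z).  FRAME: a field `K`, an AFFINE `K`-scheme `f : Y ⟶ Spec K`
and a `K`-RATIONAL POINT `t : Spec K ⟶ Y` (`t ≫ f = 𝟙`), `x := t.base (closedPoint K)`, and the stalk `R := 𝒪_{Y,x}` with its algebra structure
over the global sections `Γ(Y, ⊤)` given by the germ map (spelled `letI := (Y.presheaf.germ ⊤ x trivial).hom.toAlgebra` in every statement; it is
Mathlib's `TopCat.Presheaf.algebra_section_stalk Y.presheaf ⟨x, trivial⟩` definitionally).  The HEAD of the H1-DIM cut takes `R` as the local test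
algebra and needs exactly: `x` is a closed point ((REG) ★ `finrank_cotangentSpace_stalk_eq_of_isClosed`), `(ker t♯)·R = 𝔪_R` (the `hmax` of ★
`PoincareGrothendieckComplexResidueFieldRepr` ∕ ★ `PoincareGrothendieckComplexLocallyNilpotent` ∕ ★ `locallyNilpotent_cocycles_of_map_eq`), and
`κ(R) ≅ Γ(Spec K, ⊤)` over `Γ(Y, ⊤)` (the `he` of ★ `finrank_HmkQ_baseChangeComplex_eq_of_ringEquiv`).

* §1 `isClosedImmersion_of_comp_eq_id` — a section of the affine (hence separated) structure morphism is a closed immersion (Mathlib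
  `IsClosedImmersion.of_comp`); **`isClosed_singleton_base_closedPoint`** — `{x}` is closed (`= range t.base`, `Spec K` a point).
* §2 `mem_basicOpen_iff_not_mem_primeIdealOf'` (folklore, private copy of ★ `Modules.KernelFiniteLocallyFree.mem_basicOpen_iff_not_mem_primeIdealOf`
  to keep the imports light), `base_closedPoint_mem_basicOpen_iff` — `x ∈ D(a) ↔ t♯ a ≠ 0`; **`ker_appTop_eq_primeIdealOf`** —
  `ker t♯ = 𝔭_x ⊆ Γ(Y, ⊤)`; **`map_ker_appTop_eq_maximalIdeal_stalk`** — `(ker t♯).map (Γ(Y, ⊤) → 𝒪_{Y,x}) = 𝔪_{Y,x}` (Mathlib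
  `IsAffineOpen.isLocalization_stalk` + `IsLocalization.AtPrime.map_eq_maximalIdeal`).
* §3 `appTop_appTop_of_comp_eq_id` (`t♯ (f♯ c) = c`), `surjective_appTop_of_comp_eq_id`, `appLE_top_top_eq_appTop`,
  `stalkClosedPointTo_germ_apply` (`(𝒪_{Y,x} → K)(germ a) = ΓSpecIso (t♯ a)`, Mathlib `Scheme.stalkClosedPointTo`);
  **`exists_ringEquiv_residueField_stalk`** — `∃ e : κ(𝒪_{Y,x}) ≃+* Γ(Spec K, ⊤)` with `e (residue (germ a)) = (t.appLE ⊤ ⊤ le_top) a`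
  (descend the local homomorphism `Scheme.stalkClosedPointTo t : 𝒪_{Y,x} ⟶ K` to the residue field — injective from a field, surjective by §3).
* §4 **`isNoetherianRing_stalk`** — for `f` locally of finite type, `𝒪_{Y,x}` is noetherian (Mathlib `LocallyOfFiniteType.isLocallyNoetherian`).

HC_CM is proved only modulo the 7 printed citations until rung 0 closes; nothing here bears on a summit statement (count-neutral capital).

## References
* [Hartshorne1977] R. Hartshorne, *Algebraic Geometry* (1977), II.2 Prop. 2.2 (p. 71), II Ex. 2.7 (p. 80), II.4 Cor. 4.6 (p. 99), II Ex. 3.14.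
* [GortzWedhorn2020] U. Görtz, T. Wedhorn, *Algebraic Geometry I*, 2nd ed. (2020), §3.4 Prop. 3.33 (closed points of schemes locally of finite
  type over a field), §4.4 (`K`-valued points), Prop. 9.23 (sections of separated morphisms).
* [MumfordAV1970] D. Mumford, *Abelian Varieties* (1970), §13 (pp. 125–130) (the local ring `𝒪_{Â,0̂}` as test algebra).
-/

set_option autoImplicit false

universe u

open CategoryTheory CategoryTheory.Limits Opposite TopologicalSpace IsLocalRing

noncomputable section

namespace Literature.AlgebraicGeometry.Morphisms

open _root_.AlgebraicGeometry _root_.AlgebraicGeometry.Scheme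

variable {K : Type u} [Field K] {Y : Scheme.{u}} (f : Y ⟶ Spec (.of K)) (t : Spec (.of K) ⟶ Y)

/-! ## §1 A `K`-rational point of an affine `K`-scheme is a closed immersion; its image is a closed point -/

/-- A section `t` of the structure morphism `f : Y ⟶ Spec K` of an AFFINE `K`-scheme is a closed immersion (`f` is affine, hence separated;
`t ≫ f = 𝟙` is a closed immersion; Mathlib `IsClosedImmersion.of_comp`). [cite: GortzWedhorn2020, Prop. 9.23] [cite: Hartshorne1977, II.4 Cor. 4.6 (p. 99)] -/
theorem isClosedImmersion_of_comp_eq_id [IsAffine Y] (ht : t ≫ f = 𝟙 _) : IsClosedImmersion t := by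
  haveI : IsSeparated f := IsSeparated.of_isAffineHom f
  haveI : IsClosedImmersion (t ≫ f) := by rw [ht]; infer_instance
  exact IsClosedImmersion.of_comp t f

/-- **The image `x := t(pt)` of a `K`-rational point `t` of an affine `K`-scheme `Y` is a CLOSED point**: `{x} = range t.base` is the image of the
one-point space `Spec K` under a closed immersion. [cite: GortzWedhorn2020, §3.4 Prop. 3.33] [cite: Hartshorne1977, II Ex. 2.7 (p. 80)] -/
theorem isClosed_singleton_base_closedPoint [IsAffine Y] (ht : t ≫ f = 𝟙 _) :
    IsClosed ({t.base (closedPoint K)} : Set Y) := by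
  haveI := isClosedImmersion_of_comp_eq_id f t ht
  have hrange : Set.range t.base = {t.base (closedPoint K)} := by
    ext y
    simp only [Set.mem_range, Set.mem_singleton_iff]
    constructor
    · rintro ⟨p, rfl⟩
      rw [Subsingleton.elim p (closedPoint K)]
    · rintro rfl
      exact ⟨closedPoint K, rfl⟩
  rw [← hrange]
  exact t.isClosedEmbedding.isClosed_range

/-! ## §2 `ker t♯ = 𝔭_x` and `(ker t♯)·𝒪_{Y,x} = 𝔪_{Y,x}` -/

/-- Folklore (private copy of ★ `Modules.KernelFiniteLocallyFree.mem_basicOpen_iff_not_mem_primeIdealOf`, kept private to keep this file's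
imports light): a point of an affine open `V` lies in `D(r)` iff `r` is not in its prime ideal. [cite: Hartshorne1977, II.2 Prop. 2.2 (p. 71)] -/
private theorem mem_basicOpen_iff_not_mem_primeIdealOf' {X : Scheme.{u}} {V : X.Opens} (hV : IsAffineOpen V) (r : Γ(X, V)) {x : X}
    (hx : x ∈ V) : x ∈ X.basicOpen r ↔ r ∉ (hV.primeIdealOf ⟨x, hx⟩).asIdeal := by
  have hp : hV.fromSpec (hV.primeIdealOf ⟨x, hx⟩) = x := hV.fromSpec_primeIdealOf ⟨x, hx⟩
  rw [← PrimeSpectrum.mem_basicOpen (R := Γ(X, V)), ← hV.fromSpec_preimage_basicOpen r]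
  conv_lhs => rw [← hp]
  rfl

/-- `x = t(pt) ∈ D(a) ↔ t♯ a ≠ 0`: `t⁻¹ D(a) = D(t♯ a) ⊆ Spec K` (Mathlib `Scheme.preimage_basicOpen_top`), and in `Spec` of a field `D(s) ∋ pt ↔ s ≠ 0`.
[cite: Hartshorne1977, II.2 Prop. 2.2 (p. 71)] -/
theorem base_closedPoint_mem_basicOpen_iff (a : Γ(Y, ⊤)) :
    t.base (closedPoint K) ∈ Y.basicOpen a ↔ t.appTop.hom a ≠ 0 := by
  have hpre := Scheme.preimage_basicOpen_top t a
  rw [basicOpen_eq_of_affine'] at hpre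
  -- `x ∈ D(a) ↔ pt ∈ t⁻¹ D(a) = D(ΓSpecIso (t♯ a)) ↔ ΓSpecIso (t♯ a) ∉ 𝔪_K = ⊥`
  have key : t.base (closedPoint K) ∈ Y.basicOpen a ↔
      (Scheme.ΓSpecIso (.of K)).hom.hom (t.appTop.hom a) ∉ maximalIdeal K := by
    change closedPoint (CommRingCat.of K) ∈ t ⁻¹ᵁ Y.basicOpen a ↔ _
    rw [hpre]
    rfl
  have hinj : Function.Injective (Scheme.ΓSpecIso (.of K)).hom.hom := (Scheme.ΓSpecIso (.of K)).commRingCatIsoToRingEquiv.injective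
  rw [key, maximalIdeal_eq_bot, Ideal.mem_bot, map_eq_zero_iff _ hinj]

/-- **`ker t♯ = 𝔭_x`**: the kernel of `t♯ : Γ(Y, ⊤) → Γ(Spec K, ⊤)` is the prime ideal of `Γ(Y, ⊤)` corresponding to the point `x = t(pt)` of the
affine scheme `Y` (Mathlib `IsAffineOpen.primeIdealOf` for the affine open `⊤`). [cite: Hartshorne1977, II.2 Prop. 2.2 (p. 71), II Ex. 2.7 (p. 80)] -/
theorem ker_appTop_eq_primeIdealOf [IsAffine Y] :
    RingHom.ker t.appTop.hom = ((isAffineOpen_top Y).primeIdealOf ⟨t.base (closedPoint K), trivial⟩).asIdeal := by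
  ext a
  rw [RingHom.mem_ker, ← not_iff_not, ← mem_basicOpen_iff_not_mem_primeIdealOf' (isAffineOpen_top Y) a (x := t.base (closedPoint K)),
    base_closedPoint_mem_basicOpen_iff]

/-- **`(ker t♯)·𝒪_{Y,x} = 𝔪_{Y,x}`** — the extension of `ker t♯ ⊆ Γ(Y, ⊤)` along the germ map `Γ(Y, ⊤) → 𝒪_{Y,x}` is the maximal ideal of the
stalk: `𝒪_{Y,x}` is the localisation of `Γ(Y, ⊤)` at `𝔭_x = ker t♯` (Mathlib `IsAffineOpen.isLocalization_stalk`,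
`IsLocalization.AtPrime.map_eq_maximalIdeal`).  This is the `hmax` hypothesis of ★ `PoincareGrothendieckComplexResidueFieldRepr`.
[cite: Hartshorne1977, II.2 Prop. 2.2 (c) (p. 71)] [cite: MumfordAV1970, §13 (pp. 125–130)] -/
theorem map_ker_appTop_eq_maximalIdeal_stalk [IsAffine Y] :
    letI := (Y.presheaf.germ ⊤ (t.base (closedPoint K)) trivial).hom.toAlgebra
    (RingHom.ker t.appTop.hom).map (algebraMap Γ(Y, ⊤) (Y.presheaf.stalk (t.base (closedPoint K)))) = maximalIdeal _ := by
  letI := (Y.presheaf.germ ⊤ (t.base (closedPoint K)) trivial).hom.toAlgebra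
  haveI := (isAffineOpen_top Y).isLocalization_stalk ⟨t.base (closedPoint K), trivial⟩
  rw [ker_appTop_eq_primeIdealOf t]
  exact IsLocalization.AtPrime.map_eq_maximalIdeal _ _

/-! ## §3 The residue field of the stalk is `K` -/

/-- `t♯ (f♯ c) = c` for a section `t` of `f` (`(t ≫ f)♯ = f♯ ≫ t♯ = 𝟙`). [cite: GortzWedhorn2020, §4.4] -/
theorem appTop_appTop_of_comp_eq_id (ht : t ≫ f = 𝟙 _) (c : Γ(Spec (.of K), ⊤)) : t.appTop.hom (f.appTop.hom c) = c := by
  have h : f.appTop ≫ t.appTop = 𝟙 _ := by rw [← Scheme.Hom.comp_appTop, ht, Scheme.Hom.id_appTop]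
  have := congrArg (fun φ => φ.hom c) h
  simpa only [CommRingCat.hom_comp, RingHom.comp_apply, CommRingCat.hom_id, RingHom.id_apply] using this

/-- `t♯ : Γ(Y, ⊤) → Γ(Spec K, ⊤)` is surjective for a section `t` of `f` (cf. ★ `surjective_appTop_of_comp_hom_eq_id` for `SchemeOver`).
[cite: GortzWedhorn2020, §4.4] -/
theorem surjective_appTop_of_comp_eq_id (ht : t ≫ f = 𝟙 _) : Function.Surjective t.appTop.hom :=
  fun c => ⟨f.appTop.hom c, appTop_appTop_of_comp_eq_id f t ht c⟩

/-- `t.appLE ⊤ ⊤ le_top = t.appTop` (`t ⁻¹ᵁ ⊤ = ⊤` definitionally; Mathlib `Scheme.Hom.appLE_eq_app`). [cite: GortzWedhorn2020, §4.4] -/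
theorem appLE_top_top_eq_appTop : t.appLE ⊤ ⊤ le_top = t.appTop :=
  Scheme.Hom.appLE_eq_app t

/-- The local homomorphism `Scheme.stalkClosedPointTo t : 𝒪_{Y,x} ⟶ K` on germs of global sections: `(germ a) ↦ ΓSpecIso (t♯ a)`.
[cite: Hartshorne1977, II Ex. 2.7 (p. 80)] [cite: GortzWedhorn2020, §4.4] -/
theorem stalkClosedPointTo_germ_apply (a : Γ(Y, ⊤)) :
    (Scheme.stalkClosedPointTo t).hom ((Y.presheaf.germ ⊤ (t.base (closedPoint K)) trivial).hom a) =
      (Scheme.ΓSpecIso (.of K)).hom.hom (t.appTop.hom a) := by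
  have h := Scheme.germ_stalkClosedPointTo t ⊤ trivial
  have ha := congrArg (fun φ => φ.hom a) h
  simp only [CommRingCat.hom_comp, RingHom.comp_apply, Iso.trans_hom, Functor.mapIso_hom, Iso.op_hom, eqToIso.hom] at ha
  rw [ha]
  -- the restriction `(Spec K).presheaf.map (eqToHom _).op` along `⊤ = t ⁻¹ᵁ ⊤` (definitionally `⊤`) is the identity
  congr 1

/-- **`κ(𝒪_{Y,x}) ≅ K` AT A `K`-RATIONAL POINT, COMPATIBLY WITH `t♯`**: there is a ring isomorphism
`e : ResidueField 𝒪_{Y,x} ≃+* Γ(Spec K, ⊤)` with `e (residue (germ a)) = (t.appLE ⊤ ⊤ le_top) a` for all `a : Γ(Y, ⊤)` — the descent of the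
local homomorphism `Scheme.stalkClosedPointTo t` to the residue field (injective from a field; surjective because `Γ(Spec K) → Γ(Y) → κ(x)` is
onto by `t ≫ f = 𝟙`), followed by `ΓSpecIso⁻¹`.  This is the `he` hypothesis of ★ `finrank_HmkQ_baseChangeComplex_eq_of_ringEquiv` for
`κ := ResidueField 𝒪_{Y,x}`, `κ′ := Γ(Spec K, ⊤)` with the algebra `(t.appLE ⊤ ⊤ le_top).hom.toAlgebra`.
[cite: Hartshorne1977, II Ex. 2.7 (p. 80)] [cite: GortzWedhorn2020, §4.4] [cite: MumfordAV1970, §13 (pp. 125–130)] -/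
theorem exists_ringEquiv_residueField_stalk (ht : t ≫ f = 𝟙 _) :
    letI := (Y.presheaf.germ ⊤ (t.base (closedPoint K)) trivial).hom.toAlgebra
    ∃ e : ResidueField (Y.presheaf.stalk (t.base (closedPoint K))) ≃+* Γ(Spec (.of K), ⊤),
      ∀ a : Γ(Y, ⊤), e (residue _ (algebraMap Γ(Y, ⊤) (Y.presheaf.stalk (t.base (closedPoint K))) a)) = (t.appLE ⊤ ⊤ le_top).hom a := by
  letI := (Y.presheaf.germ ⊤ (t.base (closedPoint K)) trivial).hom.toAlgebra
  -- the local homomorphism `𝒪_{Y,x} → K` and its descent to the residue field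
  let φ : (Y.presheaf.stalk (t.base (closedPoint K)) : Type u) →+* K := (Scheme.stalkClosedPointTo t).hom
  haveI : IsLocalHom φ := Scheme.isLocalHom_stalkClosedPointTo' t
  let ψ : ResidueField (Y.presheaf.stalk (t.base (closedPoint K))) →+* Γ(Spec (.of K), ⊤) :=
    (Scheme.ΓSpecIso (.of K)).inv.hom.comp (ResidueField.lift φ)
  have hψ : ∀ a : Γ(Y, ⊤), ψ (residue _ (algebraMap Γ(Y, ⊤) (Y.presheaf.stalk (t.base (closedPoint K))) a)) = t.appTop.hom a := by
    intro a
    change (Scheme.ΓSpecIso (.of K)).inv.hom (ResidueField.lift φ (residue _ ((Y.presheaf.germ ⊤ (t.base (closedPoint K)) trivial).hom a))) = _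
    rw [ResidueField.lift_residue_apply]
    change (Scheme.ΓSpecIso (.of K)).inv.hom ((Scheme.stalkClosedPointTo t).hom _) = _
    rw [stalkClosedPointTo_germ_apply, ← RingHom.comp_apply, ← CommRingCat.hom_comp, Iso.hom_inv_id, CommRingCat.hom_id, RingHom.id_apply]
  have hinj : Function.Injective ψ :=
    (Scheme.ΓSpecIso (.of K)).commRingCatIsoToRingEquiv.symm.injective.comp (ResidueField.lift φ).injective
  have hsurj : Function.Surjective ψ := by
    intro c
    refine ⟨residue _ (algebraMap Γ(Y, ⊤) _ (f.appTop.hom c)), ?_⟩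
    rw [hψ, appTop_appTop_of_comp_eq_id f t ht]
  refine ⟨RingEquiv.ofBijective ψ ⟨hinj, hsurj⟩, fun a => ?_⟩
  rw [RingEquiv.ofBijective_apply, hψ, appLE_top_top_eq_appTop]

/-! ## §4 The stalk is noetherian (finite type over a field) -/

/-- For `f : Y ⟶ Spec K` locally of finite type, every stalk `𝒪_{Y,y}` is a noetherian ring (`Y` is locally noetherian; Mathlib
`LocallyOfFiniteType.isLocallyNoetherian`). [cite: Hartshorne1977, II Ex. 3.14] [cite: GortzWedhorn2020, §3.4 Prop. 3.33] -/
theorem isNoetherianRing_stalk [LocallyOfFiniteType f] (y : Y) : IsNoetherianRing (Y.presheaf.stalk y) := by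
  haveI : IsLocallyNoetherian Y := LocallyOfFiniteType.isLocallyNoetherian f
  infer_instance

end Literature.AlgebraicGeometry.Morphisms

end
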